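import Summits.QuantumFields.YangMills.Theorems.BalabanUVNodesN19BirkhoffContraction

/-!
# BalabanUVNodes ∕ N19 (NE7) — BIRKHOFF's CONTRACTION THEOREM, II: the LOGARITHMIC form (the sharp value of the image distance), the EXACT
# PRODUCT form `tanh(d′∕4) ≤ tanh(d∕4)·tanh(Δ∕4)`, and the `2 × 2` SHARPNESS witness

Cell `pub-ymgap` (HUMAN RULING D-0062 Track A; D-0149 width seats), seat `pub-ymgap-dag-n19-w2` (WIDTH SEAT 2 of 3 on NODE n19 = NE7), generation
g6, CLAIM-1 ∕ DECL-DELTA-1 (INBOX l.32074 ∕ l.32339).  Route `Summits/QuantumFields/YangMills/Theses/BalabanUVNodes.lean`, key item K3⁷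
`SpineGivenEndpointR13SepCoPH` (stmt-QuantumFields-20544); filed `--kind proof --supports … --as helper`.  COUNT-NEUTRAL.  THEOREMS ONLY (0 `def`,
0 `sorry`).  ADDITIVE — imports this seat's g6 `…N19BirkhoffContraction` ONLY (`two_rows_le_birkhoff`, `two_mul_log_birkhoff_le_tanh_mul`,
`tanh_quarter_eq`); modifies nothing.

CONTENTS ([folklore] = positive-operator theory with textbook locators: G. Birkhoff 1957, Trans. AMS 85; S. P. Eveson – R. D. Nussbaum 1995, Math.
Proc. Camb. Phil. Soc. 117, Thm 3.5 p. 39; L. Dubois, arXiv:0811.2930, Remark 1 p. 8 — read on the held copies).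
* §1 `tanh_quarter_le_of_exp_half_le` (`e^{d′∕2} ≤ (pq+1)∕(p+q)` ⇒ `tanh(d′∕4) ≤ tanh(d∕4)·tanh(Δ∕4)`; the Möbius map `z ↦ (z−1)∕(z+1)` is
  increasing) · ★★ `logRatio_sub_le_two_mul_log` — THE SHARP VALUE of the image Hilbert distance of two positive rows of cross-ratio diameter
  `≤ Δ` applied to two positive vectors at distance `≤ d`: `≤ 2·log((e^{(d+Δ)∕2} + 1)∕(e^{d∕2} + e^{Δ∕2}))` · ★★ `logRatio_sub_le_tanh_mul` (`≤ tanh(Δ∕4)·d`,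
  Birkhoff's coefficient) · ★★ `tanh_quarter_logRatio_sub_le` — THE EXACT PRODUCT FORM `tanh(d′∕4) ≤ tanh(d∕4)·tanh(Δ∕4)` (symmetric in the two
  roles: a kernel of diameter `Δ` and a pair of vectors at distance `d` are interchangeable; contraction coefficients compose multiplicatively).
* §2 ★ `birkhoff_sharp_toy` — SHARPNESS: the `2 × 2` kernel with rows `(q, p)`, `(1, pq)` (cross-ratio exactly `q²`) and the vectors `x = (1, 1)`,
  `y = (p², 1)` (ratio range exactly `[1, p²]`) give EQUALITY in `…N19BirkhoffContraction.sum_mul_sum_le_birkhoff` — the coefficient cannot be improved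
  for any `(d, Δ)`.
* §3 DIAMETER LETTERS (how the cross-ratio hypothesis of `…N19CoreCommonStep` §3–§4 is verified): `crossRatio_le_of_boltzmann` — rows `m τ·e^{−A σ τ}` with
  `|A| ≤ a` have diameter `≤ 4a` (EXTENSIVE when `a` is a sup-norm of an action over a block — the honest limit of the mechanism) ·
  `crossRatio_le_of_minorised` — rows pinched between `ε·m` and `m` (Doeblin-type) have diameter `≤ 2·log(1∕ε)`.

HONEST FRAMING.  Count-neutral helper; [folklore]-grade real analysis on hypothesis SHAPES; ZERO Bałaban content (no RG step of [Balaban1988Convergent] ∕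
[Balaban1989LargeFieldI ∕ II] is shown to have finite projective diameter; see `…N19CoreCommonStep` for what the mechanism does and does not give
`Spine.NE7.Core`); NE2–NE7 ∕ NE1′ NOT PRINTED for d = 4 ∕ NOT proved; N19 NOT discharged; K3⁷ OPEN, v5 untouched, not claimed; counts UNMOVED (typed
28∕28 · discharged 5∕27, A 5∕28); no count claim.  One finite 𝕋⁴ programme at fixed ε, Bałaban AS PRINTED; R4 closes the conditional finite-𝕋⁴ rung
`BalabanLadder.UV` only — the YM mass gap (Clay) is NOT proved by any of this; nothing continuum ∕ ℝ⁴ ∕ OS.  No `def`, no `instance`, no `sorry`.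
-/

noncomputable section

open Finset Real
open Summit.QuantumFields.YangMills.BalabanUVNodes.N19BirkhoffContraction (tanh_quarter_eq two_rows_le_birkhoff two_mul_log_birkhoff_le_tanh_mul)

namespace Summit.QuantumFields.YangMills.BalabanUVNodes.N19BirkhoffContractionSharp

/-! ## §1 The logarithmic forms and the exact product form -/

/-- THE PRODUCT FORM OF BIRKHOFF's COEFFICIENT: if `e^{d′∕2} ≤ (pq + 1)∕(p + q)` with `p = e^{d∕2}`, `q = e^{Δ∕2}`, then
`tanh (d′∕4) ≤ tanh (d∕4) · tanh (Δ∕4)` (the map `z ↦ (z − 1)∕(z + 1)` is increasing and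
`((pq+1) − (p+q))∕((pq+1) + (p+q)) = (p−1)(q−1)∕((p+1)(q+1))`). [folklore] (Birkhoff 1957; Dubois 2009, Rem. 1 p. 8) -/
theorem tanh_quarter_le_of_exp_half_le {d' d Δ : ℝ}
    (h : exp (d' / 2) ≤ (exp ((d + Δ) / 2) + 1) / (exp (d / 2) + exp (Δ / 2))) :
    Real.tanh (d' / 4) ≤ Real.tanh (d / 4) * Real.tanh (Δ / 4) := by
  rw [tanh_quarter_eq, tanh_quarter_eq, tanh_quarter_eq]
  set z := exp (d' / 2) with hz
  set p := exp (d / 2) with hp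
  set q := exp (Δ / 2) with hq
  have hz0 : 0 < z := exp_pos _
  have hp0 : 0 < p := exp_pos _
  have hq0 : 0 < q := exp_pos _
  have hpq : exp ((d + Δ) / 2) = p * q := by rw [hp, hq, ← exp_add]; ring_nf
  rw [hpq] at h
  -- `(z-1)/(z+1) = 1 - 2/(z+1)` is increasing in `z`
  have hmono : (z - 1) / (z + 1) ≤ ((p * q + 1) / (p + q) - 1) / ((p * q + 1) / (p + q) + 1) := by
    have hw : 0 < (p * q + 1) / (p + q) := by positivity
    rw [div_le_div_iff₀ (by positivity) (by positivity)]
    nlinarith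
  refine hmono.trans (le_of_eq ?_)
  field_simp
  ring


section TwoRows

variable {ι : Type*} {s : Finset ι} {a b x y : ι → ℝ} {d Δ : ℝ}

/-- **BIRKHOFF's THEOREM, LOGARITHMIC FORM** (the Hilbert distance of the image rows): under the hypotheses of
`two_rows_le_birkhoff` on a non-empty `s`,
`(log Σ a y − log Σ a x) − (log Σ b y − log Σ b x) ≤ 2·log ((e^{(d+Δ)∕2} + 1)∕(e^{d∕2} + e^{Δ∕2}))` — the sharp value.
[folklore] (Birkhoff 1957; Eveson–Nussbaum 1995, Thm 3.5 p. 39) -/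
theorem logRatio_sub_le_two_mul_log (hne : s.Nonempty) (hd : 0 ≤ d) (hΔ : 0 ≤ Δ)
    (ha : ∀ k ∈ s, 0 < a k) (hb : ∀ k ∈ s, 0 < b k) (hx : ∀ k ∈ s, 0 < x k) (hy : ∀ k ∈ s, 0 < y k)
    (hxy : ∀ k ∈ s, ∀ l ∈ s, y k * x l ≤ exp d * (x k * y l))
    (hab : ∀ k ∈ s, ∀ l ∈ s, a k * b l ≤ exp Δ * (a l * b k)) :
    (log (∑ k ∈ s, a k * y k) - log (∑ k ∈ s, a k * x k)) - (log (∑ k ∈ s, b k * y k) - log (∑ k ∈ s, b k * x k))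
      ≤ 2 * log ((exp ((d + Δ) / 2) + 1) / (exp (d / 2) + exp (Δ / 2))) := by
  have h := two_rows_le_birkhoff hd hΔ ha hb hx hy hxy hab
  have hAy : 0 < ∑ k ∈ s, a k * y k := sum_pos (fun k hk => mul_pos (ha k hk) (hy k hk)) hne
  have hAx : 0 < ∑ k ∈ s, a k * x k := sum_pos (fun k hk => mul_pos (ha k hk) (hx k hk)) hne
  have hBy : 0 < ∑ k ∈ s, b k * y k := sum_pos (fun k hk => mul_pos (hb k hk) (hy k hk)) hne
  have hBx : 0 < ∑ k ∈ s, b k * x k := sum_pos (fun k hk => mul_pos (hb k hk) (hx k hk)) hne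
  have hP : 0 < exp (d / 2) + exp (Δ / 2) := by positivity
  have hQ : 0 < exp ((d + Δ) / 2) + 1 := by positivity
  have h' := log_le_log (by positivity) h
  rw [log_mul (mul_pos hAy hBx).ne' (pow_pos hP 2).ne', log_mul hAy.ne' hBx.ne', log_pow,
    log_mul (mul_pos hAx hBy).ne' (pow_pos hQ 2).ne', log_mul hAx.ne' hBy.ne', log_pow] at h'
  rw [log_div hQ.ne' hP.ne']
  push_cast at h'
  linarith

/-- **THE CONTRACTION**: `(image distance) ≤ tanh (Δ∕4) · d` — Birkhoff's coefficient.
[folklore] (Birkhoff 1957; Eveson–Nussbaum 1995, Thm 3.5 p. 39) -/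
theorem logRatio_sub_le_tanh_mul (hne : s.Nonempty) (hd : 0 ≤ d) (hΔ : 0 ≤ Δ)
    (ha : ∀ k ∈ s, 0 < a k) (hb : ∀ k ∈ s, 0 < b k) (hx : ∀ k ∈ s, 0 < x k) (hy : ∀ k ∈ s, 0 < y k)
    (hxy : ∀ k ∈ s, ∀ l ∈ s, y k * x l ≤ exp d * (x k * y l))
    (hab : ∀ k ∈ s, ∀ l ∈ s, a k * b l ≤ exp Δ * (a l * b k)) :
    (log (∑ k ∈ s, a k * y k) - log (∑ k ∈ s, a k * x k)) - (log (∑ k ∈ s, b k * y k) - log (∑ k ∈ s, b k * x k))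
      ≤ Real.tanh (Δ / 4) * d :=
  (logRatio_sub_le_two_mul_log hne hd hΔ ha hb hx hy hxy hab).trans (two_mul_log_birkhoff_le_tanh_mul hd hΔ)

/-- **THE EXACT (PRODUCT) FORM** of Birkhoff's coefficient: with `d′` the image log cross-ratio of
`logRatio_sub_le_two_mul_log`, `tanh (d′∕4) ≤ tanh (d∕4) · tanh (Δ∕4)`. [folklore] (Birkhoff 1957; Dubois 2009, Rem. 1 p. 8) -/
theorem tanh_quarter_logRatio_sub_le (hne : s.Nonempty) (hd : 0 ≤ d) (hΔ : 0 ≤ Δ)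
    (ha : ∀ k ∈ s, 0 < a k) (hb : ∀ k ∈ s, 0 < b k) (hx : ∀ k ∈ s, 0 < x k) (hy : ∀ k ∈ s, 0 < y k)
    (hxy : ∀ k ∈ s, ∀ l ∈ s, y k * x l ≤ exp d * (x k * y l))
    (hab : ∀ k ∈ s, ∀ l ∈ s, a k * b l ≤ exp Δ * (a l * b k)) :
    Real.tanh (((log (∑ k ∈ s, a k * y k) - log (∑ k ∈ s, a k * x k)) -
        (log (∑ k ∈ s, b k * y k) - log (∑ k ∈ s, b k * x k))) / 4) ≤ Real.tanh (d / 4) * Real.tanh (Δ / 4) := by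
  have h := logRatio_sub_le_two_mul_log hne hd hΔ ha hb hx hy hxy hab
  have hZ : 0 < (exp ((d + Δ) / 2) + 1) / (exp (d / 2) + exp (Δ / 2)) := by positivity
  refine tanh_quarter_le_of_exp_half_le ?_
  calc exp (((log (∑ k ∈ s, a k * y k) - log (∑ k ∈ s, a k * x k)) -
          (log (∑ k ∈ s, b k * y k) - log (∑ k ∈ s, b k * x k))) / 2)
      ≤ exp (log ((exp ((d + Δ) / 2) + 1) / (exp (d / 2) + exp (Δ / 2)))) := exp_le_exp.2 (by linarith)
    _ = (exp ((d + Δ) / 2) + 1) / (exp (d / 2) + exp (Δ / 2)) := exp_log hZ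

end TwoRows

/-! ## §2 Sharpness: a `2 × 2` kernel attains Birkhoff's bound -/

/-- **SHARPNESS** of `sum_mul_sum_le_birkhoff` ∕ `two_rows_le_birkhoff`: rows `a = (q, p)`, `b = (1, pq)` (cross-ratio
exactly `q²`) and vectors `x = (1, 1)`, `y = (p², 1)` (ratio range exactly `[1, p²]`) give EQUALITY
`(Σ a y)(Σ b x)(p + q)² = (Σ a x)(Σ b y)(pq + 1)²` (both sides `= p(pq+1)²(p+q)²`): Birkhoff's coefficient cannot be
improved. [folklore] -/
theorem birkhoff_sharp_toy (p q : ℝ) :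
    (∑ k : Fin 2, ![q, p] k * ![p ^ 2, 1] k) * (∑ k : Fin 2, ![1, p * q] k * ![(1 : ℝ), 1] k) * (p + q) ^ 2 =
      (∑ k : Fin 2, ![q, p] k * ![(1 : ℝ), 1] k) * (∑ k : Fin 2, ![1, p * q] k * ![p ^ 2, 1] k) * (p * q + 1) ^ 2 := by
  simp [Fin.sum_univ_two]
  ring


/-! ## §3 Two diameter letters: how a cross-ratio bound is verified -/

section Diameter

variable {ι κ : Type*} {s : Finset ι} {R : Finset κ}

/-- **BOLTZMANN ROWS HAVE DIAMETER `≤ 4·sup|A|`** [folklore]: rows `M σ τ = m τ · e^{−A σ τ}` (a common reference weight `m ≥ 0` times a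
Boltzmann factor) with `|A σ τ| ≤ a` on `R × s` satisfy the cross-ratio bound `M σ τ · M σ′ τ′ ≤ e^{4a} · M σ τ′ · M σ′ τ`.  This is why the
projective diameter of a realistic lattice step is EXTENSIVE: `a` is a sup-norm of an action over a block. -/
theorem crossRatio_le_of_boltzmann {m : ι → ℝ} {A : κ → ι → ℝ} {a : ℝ}
    (hm : ∀ τ ∈ s, 0 ≤ m τ) (hA : ∀ σ ∈ R, ∀ τ ∈ s, |A σ τ| ≤ a) :
    ∀ σ ∈ R, ∀ σ' ∈ R, ∀ τ ∈ s, ∀ τ' ∈ s,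
      (m τ * exp (-A σ τ)) * (m τ' * exp (-A σ' τ')) ≤ exp (4 * a) * ((m τ' * exp (-A σ τ')) * (m τ * exp (-A σ' τ))) := by
  intro σ hσ σ' hσ' τ hτ τ' hτ'
  have h1 := abs_le.1 (hA σ hσ τ hτ)
  have h2 := abs_le.1 (hA σ' hσ' τ' hτ')
  have h3 := abs_le.1 (hA σ hσ τ' hτ')
  have h4 := abs_le.1 (hA σ' hσ' τ hτ)
  have hexp : exp (-A σ τ) * exp (-A σ' τ') ≤ exp (4 * a) * (exp (-A σ τ') * exp (-A σ' τ)) := by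
    rw [← exp_add, ← exp_add, ← exp_add]
    exact exp_le_exp.2 (by linarith)
  calc m τ * exp (-A σ τ) * (m τ' * exp (-A σ' τ'))
      = (m τ * m τ') * (exp (-A σ τ) * exp (-A σ' τ')) := by ring
    _ ≤ (m τ * m τ') * (exp (4 * a) * (exp (-A σ τ') * exp (-A σ' τ))) :=
        mul_le_mul_of_nonneg_left hexp (mul_nonneg (hm τ hτ) (hm τ' hτ'))
    _ = exp (4 * a) * ((m τ' * exp (-A σ τ')) * (m τ * exp (-A σ' τ))) := by ring

/-- **MINORISED ROWS HAVE DIAMETER `≤ 2·log(1∕ε)`** [folklore] (Doeblin-type letter): rows pinched between `ε·m` and `m` for a common reference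
weight `m ≥ 0` and `0 < ε` satisfy `M σ τ · M σ′ τ′ ≤ ε⁻² · M σ τ′ · M σ′ τ`. -/
theorem crossRatio_le_of_minorised {M : κ → ι → ℝ} {m : ι → ℝ} {ε : ℝ} (hε : 0 < ε)
    (hm : ∀ τ ∈ s, 0 ≤ m τ) (hlo : ∀ σ ∈ R, ∀ τ ∈ s, ε * m τ ≤ M σ τ) (hhi : ∀ σ ∈ R, ∀ τ ∈ s, M σ τ ≤ m τ) :
    ∀ σ ∈ R, ∀ σ' ∈ R, ∀ τ ∈ s, ∀ τ' ∈ s, M σ τ * M σ' τ' ≤ (ε ^ 2)⁻¹ * (M σ τ' * M σ' τ) := by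
  intro σ hσ σ' hσ' τ hτ τ' hτ'
  have hM0 : ∀ ρ ∈ R, ∀ υ ∈ s, 0 ≤ M ρ υ := fun ρ hρ υ hυ =>
    (mul_nonneg hε.le (hm υ hυ)).trans (hlo ρ hρ υ hυ)
  have hup : M σ τ * M σ' τ' ≤ m τ * m τ' := mul_le_mul (hhi σ hσ τ hτ) (hhi σ' hσ' τ' hτ') (hM0 σ' hσ' τ' hτ') (hm τ hτ)
  have hdn : ε ^ 2 * (m τ' * m τ) ≤ M σ τ' * M σ' τ := by
    calc ε ^ 2 * (m τ' * m τ) = (ε * m τ') * (ε * m τ) := by ring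
      _ ≤ M σ τ' * M σ' τ := mul_le_mul (hlo σ hσ τ' hτ') (hlo σ' hσ' τ hτ) (mul_nonneg hε.le (hm τ hτ)) (hM0 σ hσ τ' hτ')
  rw [← div_eq_inv_mul, le_div_iff₀ (pow_pos hε 2)]
  calc M σ τ * M σ' τ' * ε ^ 2 ≤ m τ * m τ' * ε ^ 2 := mul_le_mul_of_nonneg_right hup (sq_nonneg ε)
    _ = ε ^ 2 * (m τ' * m τ) := by ring
    _ ≤ M σ τ' * M σ' τ := hdn

end Diameter

end Summit.QuantumFields.YangMills.BalabanUVNodes.N19BirkhoffContractionSharp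

end
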